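import Literature.MathematicalPhysics.QuantumFieldTheory.WightmanProofs
import HarnessLib

/-!
# The cluster property along space-like directions from the cluster property along spatial ones

Topic `Literature/MathematicalPhysics/QuantumFieldTheory`; a step in the decomposition of the
named fact `Literature.MathematicalPhysics.QuantumFieldTheory.OS1973_cluster` — conjunct (A₃, R4)
of `OS1973_isWightmanFamily_of_continuation` / `os_reconstruction` (`WightmanProofs`).

Osterwalder–Schrader I (CMP 31 (1973)), §4.4 derive the cluster property (R4) of the Wightman
distributions from the Euclidean cluster property (E4) "in vector notation", eq. (4.30):
`lim_{λ→∞} (u(h), U_s(λa) u(k)) = (u(h), Ω)(Ω, u(k))`, where `U_s` is the unitary representation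
of the *spatial* translations of §4.1 (4.5) and `a = (0, a⃗)` is purely spatial — exactly as in
(E4), p. 88, "`a = (0, a⃗)`, `a⃗ ∈ ℝ³`". The Wightman axiom (R4) as printed by Streater–Wightman,
§3-4 (3-31) (the tree's `Literature.Analysis.FunctionSpaces.HasClusterProperty`) asks for
`𝒲_{n+m}(F ⊗ G_{(λa)}) → 𝒲ₙ(F) 𝒲ₘ(G)` for every **space-like** `a`. The passage from spatial to
space-like directions is relativistic invariance (R1): a space-like `a` is carried to a purely
spatial vector by a restricted Lorentz transformation (a rotation aligning `a⃗` with `e₁`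
followed by a boost in the `(0,1)`-plane of rapidity `artanh(∓a⁰/‖a⃗‖)`), and the diagonal
action of `L↑₊` on test functions maps the tensor products `F ⊗ G_{(λa)}` to
`F' ⊗ G'_{(λ Λa)}`. This file proves that reduction for an arbitrary family of distributions:

* `HasSpatialClusterProperty 𝒲` — (3-31) restricted to purely spatial nonzero `a`
  (the form in which OS I (4.30) delivers it);
* `exists_restrictedLorentz_apply_zero_eq_zero` — for space-like `a` (`d ≥ 1`) there is
  `M ∈ L↑₊` with `(M a)⁰ = 0`, `M a ≠ 0`;
* `WightmanFamily.hasClusterProperty_of_spatial` — a Poincaré-invariant family with the spatial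
  cluster property has the cluster property (3-31); `hasClusterProperty_iff_spatial`;
* `IsOSContinuationFamily.hasClusterProperty_of_spatial`, `OS1973_cluster_of_spatial` — for OS
  continuation families Poincaré invariance is a theorem of the tree
  (`IsOSContinuationFamily.isPoincareInvariantFamily`, from E1), so `OS1973_cluster` reduces to
  its spatial version, i.e. to OS I (4.30) read on the boundary distributions.

## References

* K. Osterwalder, R. Schrader, *Axioms for Euclidean Green's functions*, Comm. Math. Phys. 31
  (1973) 83–112, §3 (E4) p. 88, §4.4 eqs. (4.29)–(4.30) p. 96–97. [OsterwalderSchraderCMP1973]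
* R. F. Streater, A. S. Wightman, *PCT, Spin and Statistics, and All That* (1964), §3-4
  eq. (3-31); §1-3 (boosts). [StreaterWightman1964]

## Tree

Used: `exists_det_eq_one_map_eq_smul_single`, `boost_mem_restrictedLorentzGroup_holds`,
`spatialRotation_mem_restrictedLorentzGroup_holds` (`LorentzSpectralSupport`), `boost`,
`spatialRotation`, `poincareTestMulti` (`MinkowskiGeometry`), `IsAppendTensorOf`, `translateMulti`,
`IsOSContinuationFamily.isPoincareInvariantFamily` (`WightmanProofs`).
-/

noncomputable section

open Filter Topology
open scoped SchwartzMap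
open Literature.MathematicalPhysics.QuantumLattice Literature.Analysis.FunctionSpaces

namespace Literature.MathematicalPhysics.QuantumFieldTheory

variable {d : ℕ}

/-! ### Boost geometry: a space-like vector is a restricted Lorentz transform of a spatial one -/

/-- **Rapidity annihilating the time component**: if `|t| < |b|` there is `σ` with
`cosh σ · t + sinh σ · b = 0` (namely `e^{2σ} = (b − t)/(b + t)`, i.e. `tanh σ = −t/b`). [folklore] -/
theorem exists_cosh_mul_add_sinh_mul_eq_zero {t b : ℝ} (h : |t| < |b|) :
    ∃ σ : ℝ, Real.cosh σ * t + Real.sinh σ * b = 0 := by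
  have hb0 : b ≠ 0 := fun hb => by
    rw [hb, abs_zero] at h
    exact absurd h (not_lt.2 (abs_nonneg t))
  have ht : -|b| < t ∧ t < |b| := abs_lt.1 h
  have hq : 0 < (b - t) / (b + t) := by
    rcases lt_or_gt_of_ne hb0 with hb | hb
    · rw [abs_of_neg hb] at ht
      exact div_pos_of_neg_of_neg (by linarith [ht.1]) (by linarith [ht.2])
    · rw [abs_of_pos hb] at ht
      exact div_pos (by linarith [ht.2]) (by linarith [ht.1])
  have hbt : b + t ≠ 0 := fun h0 => by
    rw [h0, div_zero] at hq
    exact lt_irrefl _ hq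
  set q : ℝ := (b - t) / (b + t) with hq_def
  set σ : ℝ := Real.log q / 2 with hσ
  refine ⟨σ, ?_⟩
  set u : ℝ := Real.exp σ with hu
  set w : ℝ := Real.exp (-σ) with hw
  have hexp : u * u = q := by
    rw [hu, ← Real.exp_add, show σ + σ = Real.log q by rw [hσ]; ring, Real.exp_log hq]
  have hmul : u * w = 1 := by rw [hu, hw, ← Real.exp_add, add_neg_cancel, Real.exp_zero]
  have hqbt : q * (b + t) = b - t := div_mul_cancel₀ _ hbt
  have key : u * ((u + w) * t + (u - w) * b) = 0 := by
    linear_combination (t + b) * hexp + (t - b) * hmul + hqbt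
  have hu0 : u ≠ 0 := (Real.exp_pos σ).ne'
  have key' : (u + w) * t + (u - w) * b = 0 := by
    rcases mul_eq_zero.1 key with h1 | h1
    · exact absurd h1 hu0
    · exact h1
  rw [Real.cosh_eq, Real.sinh_eq]
  linear_combination key' / 2

/-- A space-like vector has `|a⁰| < ‖a⃗‖`. [folklore] -/
theorem abs_time_lt_norm_spaceC_of_isSpacelike {a : SpaceTime d} (ha : IsSpacelike a) :
    |a 0| < ‖spaceC d a‖ := by
  rw [IsSpacelike, minkowskiForm_self] at ha
  have h : (a 0) ^ 2 < ‖spaceC d a‖ ^ 2 := by linarith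
  exact abs_lt_of_sq_lt_sq' h (norm_nonneg _) |> fun h' => abs_lt.2 h'

/-- A space-like vector is nonzero. [folklore] -/
theorem ne_zero_of_isSpacelike {a : SpaceTime d} (ha : IsSpacelike a) : a ≠ 0 := by
  rintro rfl
  simp [IsSpacelike] at ha

/-- A nonzero purely spatial vector (`a⁰ = 0`) is space-like. [folklore] -/
theorem isSpacelike_of_apply_zero_eq_zero {a : SpaceTime d} (h0 : a 0 = 0) (hne : a ≠ 0) :
    IsSpacelike a := by
  rw [IsSpacelike, minkowskiForm_self, h0]
  have hv : spaceC d a ≠ 0 := fun hv => hne (by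
    rw [← ofTimeSpace_apply_zero_spaceC a, h0, hv]
    ext j
    refine Fin.cases ?_ (fun i => ?_) j <;> simp)
  have : 0 < ‖spaceC d a‖ := norm_pos_iff.2 hv
  nlinarith

/-- **A space-like vector is Lorentz-equivalent to a purely spatial one** (`d ≥ 1`): for
space-like `a` there is `M ∈ L↑₊` with `(M a)⁰ = 0` (and `M a ≠ 0`) — a rotation of `SO(d)` taking
`a⃗` to `±‖a⃗‖ e₁` (`exists_det_eq_one_map_eq_smul_single`) followed by the boost in the
`(0,1)`-plane of the rapidity of `exists_cosh_mul_add_sinh_mul_eq_zero`. [cite: StreaterWightman1964, §1-3] -/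
theorem exists_restrictedLorentz_apply_zero_eq_zero [NeZero d] {a : SpaceTime d}
    (ha : IsSpacelike a) :
    ∃ M : SpaceTime d ≃L[ℝ] SpaceTime d,
      M ∈ restrictedLorentzGroup d ∧ (M a) 0 = 0 ∧ M a ≠ 0 := by
  have hlt := abs_time_lt_norm_spaceC_of_isSpacelike ha
  set v : EuclideanSpace ℝ (Fin d) := spaceC d a with hv
  have hv0 : v ≠ 0 := fun h => by
    rw [h, norm_zero] at hlt
    exact absurd hlt (not_lt.2 (abs_nonneg _))
  obtain ⟨R, hRdet, hRv⟩ := exists_det_eq_one_map_eq_smul_single hv0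
  have hb : |(R v) (0 : Fin d)| = ‖v‖ := by
    rcases hRv with h | h
    · rw [h]
      simp [abs_of_nonneg (norm_nonneg v)]
    · rw [h]
      simp [abs_of_nonneg (norm_nonneg v)]
  obtain ⟨σ, hσ⟩ := exists_cosh_mul_add_sinh_mul_eq_zero (t := a 0) (b := (R v) (0 : Fin d))
    (by rwa [hb])
  set Λ₁ := spatialRotation R.toContinuousLinearEquiv with hΛ₁
  set M := boost (0 : Fin d) σ * Λ₁ with hM
  have hΛ₁m : Λ₁ ∈ restrictedLorentzGroup d :=
    spatialRotation_mem_restrictedLorentzGroup_holds R hRdet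
  refine ⟨M, (restrictedLorentzGroup d).mul_mem (boost_mem_restrictedLorentzGroup_holds 0 σ) hΛ₁m,
    ?_, fun h => ne_zero_of_isSpacelike ha (M.injective (h.trans (map_zero M).symm))⟩
  rw [hM, continuousLinearEquiv_mul_apply, boost_apply, boostLin_apply, if_pos rfl, hΛ₁,
    spatialRotation_apply, ofTimeSpace_apply_zero, timeC_apply]
  simp only [LinearIsometryEquiv.coe_toContinuousLinearEquiv]
  rw [ofTimeSpace_apply_succ]
  exact hσ

/-! ### Transport of tensor products under the diagonal Lorentz action -/

/-- The diagonal action of a pure Lorentz transformation on `n`-point test functions: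
`(Λ • F)(x) = F(Λ⁻¹ x₁, …, Λ⁻¹ xₙ)`. [folklore] -/
theorem poincareTestMulti_inr_apply (n : ℕ) (Λ : restrictedLorentzGroup d)
    (F : 𝓢((Fin n → SpaceTime d), ℂ)) (x : Fin n → SpaceTime d) :
    poincareTestMulti n (SemidirectProduct.inr Λ) F x =
      F (fun k => (Λ : SpaceTime d ≃L[ℝ] SpaceTime d).symm (x k)) := by
  rw [poincareTestMulti_apply]
  simp

/-- The diagonal Poincaré action maps append-tensor products to append-tensor products. [folklore] -/
theorem _root_.Literature.MathematicalPhysics.QuantumLattice.IsAppendTensorOf.poincareTestMulti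
    {n m : ℕ} {H : 𝓢((Fin (n + m) → SpaceTime d), ℂ)} {F : 𝓢((Fin n → SpaceTime d), ℂ)}
    {G : 𝓢((Fin m → SpaceTime d), ℂ)} (hH : IsAppendTensorOf H F G) (g : PoincareGroup d) :
    IsAppendTensorOf (poincareTestMulti (n + m) g H) (poincareTestMulti n g F)
      (poincareTestMulti m g G) := by
  intro x
  simp only [poincareTestMulti_apply]
  rw [hH]
  rfl

/-- A pure Lorentz transformation intertwines the diagonal translations:
`Λ • (G(· − b)) = (Λ • G)(· − Λ b)`. [folklore] -/
theorem poincareTestMulti_inr_translateMulti (m : ℕ) (Λ : restrictedLorentzGroup d) (b : SpaceTime d)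
    (G : 𝓢((Fin m → SpaceTime d), ℂ)) :
    poincareTestMulti m (SemidirectProduct.inr Λ) (translateMulti b G) =
      translateMulti ((Λ : SpaceTime d ≃L[ℝ] SpaceTime d) b)
        (poincareTestMulti m (SemidirectProduct.inr Λ) G) := by
  ext x
  rw [poincareTestMulti_inr_apply, translateMulti_apply, translateMulti_apply,
    poincareTestMulti_inr_apply]
  congr 1
  funext k
  rw [map_sub, ContinuousLinearEquiv.symm_apply_apply]

/-! ### The spatial cluster property and the reduction -/

variable {κ : Type*}

/-- **The cluster property along spatial directions** of a family of distributions `𝒲`: for every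
nonzero purely spatial `a = (0, a⃗)`, `𝒲_{n+m}(F ⊗ G_{(λa)}) → 𝒲ₙ(F) 𝒲ₘ(G)` as `λ → ∞` (tensor
products in witness form, as in `HasClusterProperty`). This is Streater–Wightman (3-31) restricted
to the directions of Osterwalder–Schrader's (E4)/(4.30), `a = (0, a⃗)`, `a⃗ ∈ ℝ^d ∖ {0}`. [cite: OsterwalderSchraderCMP1973, §4.4 eqs. (4.29)–(4.30)] -/
def _root_.Literature.Analysis.FunctionSpaces.HasSpatialClusterProperty (𝒲 : WightmanFamily d κ) : Prop :=
  ∀ (n m : ℕ) (kn : Fin n → κ) (km : Fin m → κ) (F : 𝓢((Fin n → SpaceTime d), ℂ))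
    (G : 𝓢((Fin m → SpaceTime d), ℂ)) (a : SpaceTime d), a 0 = 0 → a ≠ 0 →
      ∀ H : ℝ → 𝓢((Fin (n + m) → SpaceTime d), ℂ),
        (∀ t, IsAppendTensorOf (H t) F (translateMulti (t • a) G)) →
          Tendsto (fun t : ℝ => 𝒲 (n + m) (Fin.append kn km) (H t)) atTop
            (𝓝 (𝒲 n kn F * 𝒲 m km G))

/-- The cluster property (all space-like directions) implies the spatial one. [folklore] -/
theorem _root_.Literature.Analysis.FunctionSpaces.HasClusterProperty.hasSpatialClusterProperty
    {𝒲 : WightmanFamily d κ} (h : HasClusterProperty 𝒲) : HasSpatialClusterProperty 𝒲 :=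
  fun n m kn km F G a ha0 hane H hH =>
    h n m kn km F G a (isSpacelike_of_apply_zero_eq_zero ha0 hane) H hH

/-- **Spatial cluster property plus relativistic invariance give the cluster property (3-31)**
(`d ≥ 1`). For space-like `a` choose `M ∈ L↑₊` with `M a` purely spatial
(`exists_restrictedLorentz_apply_zero_eq_zero`); the diagonal action of `M` sends a witness of
`F ⊗ G_{(λa)}` to a witness of `(M•F) ⊗ (M•G)_{(λ Ma)}`
(`IsAppendTensorOf.poincareTestMulti`, `poincareTestMulti_inr_translateMulti`), the spatial
cluster property applies to the transformed data, and invariance (a) removes `M` from all three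
distributions. [cite: StreaterWightman1964, §3-4 eq. (3-31)] -/
theorem _root_.Literature.Analysis.FunctionSpaces.WightmanFamily.hasClusterProperty_of_spatial
    [NeZero d] {𝒲 : WightmanFamily d κ} (hP : IsPoincareInvariantFamily 𝒲)
    (h : HasSpatialClusterProperty 𝒲) : HasClusterProperty 𝒲 := by
  intro n m kn km F G a ha H hH
  obtain ⟨M, hM, hM0, hMne⟩ := exists_restrictedLorentz_apply_zero_eq_zero ha
  set Λ : restrictedLorentzGroup d := ⟨M, hM⟩ with hΛ
  set g : PoincareGroup d := SemidirectProduct.inr Λ with hg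
  have hH' : ∀ t, IsAppendTensorOf (poincareTestMulti (n + m) g (H t)) (poincareTestMulti n g F)
      (translateMulti (t • M a) (poincareTestMulti m g G)) := fun t => by
    have h1 := (hH t).poincareTestMulti g
    rw [hg, poincareTestMulti_inr_translateMulti, map_smul] at h1
    exact h1
  have hlim := h n m kn km _ _ (M a) hM0 hMne _ hH'
  have e1 : (fun t : ℝ => 𝒲 (n + m) (Fin.append kn km) (poincareTestMulti (n + m) g (H t))) =
      fun t => 𝒲 (n + m) (Fin.append kn km) (H t) := funext fun t => hP g _ _ _
  rw [e1, hP g n kn F, hP g m km G] at hlim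
  exact hlim

/-- For a Poincaré-invariant family (`d ≥ 1`) the cluster property is equivalent to its spatial
version. [folklore] -/
theorem _root_.Literature.Analysis.FunctionSpaces.WightmanFamily.hasClusterProperty_iff_spatial
    [NeZero d] {𝒲 : WightmanFamily d κ} (hP : IsPoincareInvariantFamily 𝒲) :
    HasClusterProperty 𝒲 ↔ HasSpatialClusterProperty 𝒲 :=
  ⟨fun h => h.hasSpatialClusterProperty, fun h => WightmanFamily.hasClusterProperty_of_spatial hP h⟩

/-! ### Application to OS continuation families -/

variable {S : SchwingerFamily (EuclideanSpace ℝ (Fin (d + 1)))} {𝒲 : WightmanFamily d Unit}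

/-- **For an OS continuation family the spatial cluster property suffices** (its Poincaré
invariance is a theorem, `IsOSContinuationFamily.isPoincareInvariantFamily`, from E1). [cite: OsterwalderSchraderCMP1973, §4.4 eqs. (4.29)–(4.30)] -/
theorem IsOSContinuationFamily.hasClusterProperty_of_spatial [NeZero d]
    (hE1 : S.IsEuclideanCovariant) (h : IsOSContinuationFamily S 𝒲)
    (hsp : HasSpatialClusterProperty 𝒲) : HasClusterProperty 𝒲 :=
  WightmanFamily.hasClusterProperty_of_spatial (h.isPoincareInvariantFamily hE1) hsp

/-- **`OS1973_cluster` reduces to its spatial version**: it suffices to prove, for every OS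
family with E0' and its continuation family `𝒲`, the cluster property along nonzero purely
spatial directions — which is what Osterwalder–Schrader I, §4.4 (4.30) gives. Real proof. [cite: OsterwalderSchraderCMP1973, §4.4 eqs. (4.29)–(4.30)] -/
theorem OS1973_cluster_of_spatial
    (h : ∀ (d : ℕ) [NeZero d] (S : SchwingerFamily (EuclideanSpace ℝ (Fin (d + 1)))),
      S.IsOSFamily → S.HasLinearGrowth → ∀ 𝒲 : WightmanFamily d Unit,
        IsOSContinuationFamily S 𝒲 → HasSpatialClusterProperty 𝒲) :
    OS1973_cluster :=
  fun d _ S hS hE0' 𝒲 h𝒲 =>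
    h𝒲.hasClusterProperty_of_spatial hS.covariant (h d S hS hE0' 𝒲 h𝒲)

end Literature.MathematicalPhysics.QuantumFieldTheory
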